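import Literature.Probability.Percolation.FlipResponse

/-!
# Telescoping of flip responses along a flip sequence (Russo-type identity, discrete form)

Helper file for the crux `QuadrupoleSelectionRule` (stmt-CriticalPhenomena-7029, informal) of route
`CardyFlipRusso` (sub-problem `CardyFormulaZ2`), line `Sketch`: the discrete skeleton of the
"wanted lemma (3)" of `Literature/Probability/Percolation/FlipResponse.lean` — along a sequence
of graphs in which each graph is obtained from the previous one by a diagonal flip, the total
change of the probability of a graph-dependent event is the sum of the flip responses
(Beffara 2008, §5.2 Prop. 18 is the continuous-parameter template; here the exact finite
telescoping identity, with no measurability or independence hypothesis).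
-/

noncomputable section

open MeasureTheory

namespace Summit.CriticalPhenomena.CardyFormulaZ2.Theorems

open Literature.Probability.Percolation

variable {V : Type*}

/-- **Telescoping identity along a flip sequence.** If `G (i+1)` is the diagonal flip of `G i` at
the quadrilateral `(A i, B i, C i, D i)` for every `i < n`, then
`P_p[U(G n)] − P_p[U(G 0)] = ∑_{i<n} Δ_{Q_i}(U)`. [folklore] -/
theorem flipResponse_sum_range (G : ℕ → SimpleGraph V) (A B C D : ℕ → V)
    (U : SimpleGraph V → Set (SiteConfig V)) (p : unitInterval) (n : ℕ)
    (hstep : ∀ i < n, G (i + 1) = flipGraph (G i) (A i) (B i) (C i) (D i)) :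
    ∑ i ∈ Finset.range n, flipResponse (G i) (A i) (B i) (C i) (D i) U p
      = (sitePercolation V p (U (G n))).toReal - (sitePercolation V p (U (G 0))).toReal := by
  induction n with
  | zero => simp
  | succ n ih =>
    rw [Finset.sum_range_succ, ih fun i hi => hstep i (Nat.lt_succ_of_lt hi), flipResponse_def,
      ← hstep n (Nat.lt_succ_self n)]
    ring

/-- The same identity read as a bound: the total change of probability along a flip sequence is
at most the sum of the absolute flip responses. [folklore] -/
theorem abs_sub_le_sum_abs_flipResponse (G : ℕ → SimpleGraph V) (A B C D : ℕ → V)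
    (U : SimpleGraph V → Set (SiteConfig V)) (p : unitInterval) (n : ℕ)
    (hstep : ∀ i < n, G (i + 1) = flipGraph (G i) (A i) (B i) (C i) (D i)) :
    |(sitePercolation V p (U (G n))).toReal - (sitePercolation V p (U (G 0))).toReal|
      ≤ ∑ i ∈ Finset.range n, |flipResponse (G i) (A i) (B i) (C i) (D i) U p| := by
  rw [← flipResponse_sum_range G A B C D U p n hstep]
  exact Finset.abs_sum_le_sum_abs _ _

end Summit.CriticalPhenomena.CardyFormulaZ2.Theorems

end
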